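import Summits.Parity.BatemanHorn.Theorems.SoloInformedTrapezoidWeights

/-!
# Variation of the kernel sums in the modulus: `K_{e+1}(h) − K_e(h)`

Informed soloist `solo-Parity-informed` (session 143), conjunct `BatemanHorn`, the `d ≥ 3` rung BELOW the parity
wall.  For kernel sums `K_N(Φ; e(−h/e)) = ∑_{m≤N} Φ(m) e(−hm/e)` (`SoloInformedAbelKernel`) we control the
dependence on the modulus `e`, which is what Abel summation in `e` against an `ℓ¹`-in-`h` mean-value hypothesis for
the Hooley sums `S_g(h; e)` consumes:

* `kernelSum_succ_modulus_sub`: for two weight sequences `Φ, Φ'`,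
  `K_N(Φ'; e(−h/(e+1))) − K_N(Φ; e(−h/e)) = K_N(Φ' − Φ; e(−h/(e+1))) + K_N(Φ·(ξ^· − 1); e(−h/e))`,
  `ξ = e(h/(e(e+1)))` — weight variation plus phase variation;
* `norm_kernelSum_phase_le`: the phase-variation kernel obeys the SECOND-order bound
  `|K_N(Φ(ξ^· − 1); e(−h/e))| ≤ (π/(8|h|))·(N·V₂(Φ) + 2V₁(Φ)) + (π²/(4e²))·∑|Φ|`
  (second Leibniz rule with `|ξ^m − 1| ≤ m|ξ − 1|`, `|ξ − 1| ≤ 2π|h|/(e(e+1))`, and Jordan): one order of decay in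
  `h` is traded for the smallness `|ξ − 1| ≍ |h|/e²` of the phase increment;
* the trapezoid specialisations `norm_trapKernelSum_le_first` (`|K_e(h)| ≤ D·e/(2|h|)`),
  `norm_trapKernelSum_psi_le` (`|K_N(Ψ_e; e(−h/(e+1)))| ≤ D(e+1)σ_e/|h|`) and `norm_trapKernelSum_phase_le`, with
  `V₂(Φ_e) ≤ V` kept as a hypothesis (`SoloInformedTrapezoidSecondVariation` supplies it).
-/

namespace Summit.Parity.BatemanHorn.Theorems

open Finset Polynomial

/-! ### Weight variation plus phase variation -/

/-- **`K_N(Φ'; e(−h/(e+1))) − K_N(Φ; e(−h/e)) = K_N(Φ' − Φ; e(−h/(e+1))) + K_N(Φ(ξ^· − 1); e(−h/e))`**,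
`ξ = e(h/(e(e+1)))` (`e ≠ 0`). [this work] -/
theorem kernelSum_succ_modulus_sub (N : ℕ) (Φ Φ' : ℕ → ℂ) {e : ℕ} (he : e ≠ 0) (h : ℤ) :
    kernelSum N Φ' (eAdd (e + 1) (-h)) - kernelSum N Φ (eAdd e (-h))
      = kernelSum N (fun m => Φ' m - Φ m) (eAdd (e + 1) (-h))
        + kernelSum N (fun m => Φ m * (eAdd (e * (e + 1)) h ^ m - 1)) (eAdd e (-h)) := by
  rw [show (e : ℕ) + 1 = (e + 1 : ℕ) from rfl, kernelSum_eAdd, kernelSum_eAdd, kernelSum_eAdd, kernelSum_eAdd,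
    ← sum_sub_distrib, ← sum_add_distrib]
  refine sum_congr rfl fun m _ => ?_
  have h2 : eAdd (e + 1) (-(h * m)) = eAdd e (-(h * m)) * eAdd (e * (e + 1)) h ^ m :=
    eAdd_succ_neg_mul_eq e he h m
  rw [h2]
  ring

/-! ### The phase-variation kernel -/

/-- **Second-order bound for the phase-variation kernel** with an abstract unimodular `ξ`:
`|K_N(Φ(ξ^· − 1); e(−h/e))| ≤ (e/(4|h|))²·(N|ξ−1|·V₂(Φ) + 2|ξ−1|·V₁(Φ) + |ξ−1|²·∑|Φ|)`
(`Φ(N) = Φ(N−1) = 0`, `h ≠ 0`, `2|h| ≤ e`, `|ξ| = 1`). [this work] -/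
theorem norm_kernelSum_mul_pow_sub_one_le (N : ℕ) {Φ : ℕ → ℂ} (hN : Φ N = 0) (hN' : Φ (N - 1) = 0)
    {e : ℕ} {h : ℤ} (h0 : h ≠ 0) (h2 : 2 * |h| ≤ (e : ℤ)) {ξ : ℂ} (hξ : ‖ξ‖ = 1) :
    ‖kernelSum N (fun m => Φ m * (ξ ^ m - 1)) (eAdd e (-h))‖
      ≤ ((N : ℝ) * ‖ξ - 1‖ * ∑ m ∈ range (N + 1), ‖bdiff (bdiff Φ) m‖
          + 2 * ‖ξ - 1‖ * ∑ m ∈ range (N + 1), ‖bdiff Φ m‖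
          + ‖ξ - 1‖ ^ 2 * ∑ m ∈ range (N + 1), ‖Φ m‖) * ((e : ℝ) / (4 * |(h : ℝ)|)) ^ 2 := by
  have htop : (fun m => Φ m * (ξ ^ m - 1)) N = 0 := by simp [hN]
  have htop' : (fun m => Φ m * (ξ ^ m - 1)) (N - 1) = 0 := by simp [hN']
  refine (norm_kernelSum_eAdd_le_second N htop htop' h0 h2).trans (mul_le_mul_of_nonneg_right ?_ (sq_nonneg _))
  have hρ0 : 0 ≤ ‖ξ - 1‖ := norm_nonneg _
  refine sum_norm_bdiff_bdiff_mul_le N Φ (fun m => ξ ^ m - 1) hρ0 (sq_nonneg _) ?_ ?_ ?_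
  · intro m hm
    have hmN : (m : ℝ) ≤ N := by exact_mod_cast Nat.lt_succ_iff.mp (mem_range.mp hm)
    calc ‖ξ ^ m - 1‖ ≤ m * ‖ξ - 1‖ := norm_pow_sub_one_le hξ m
      _ ≤ N * ‖ξ - 1‖ := mul_le_mul_of_nonneg_right hmN hρ0
  · intro m _ hm
    exact (norm_bdiff_pow_sub_one hξ hm).le
  · intro m _ hm
    exact (norm_bdiff_bdiff_pow_sub_one hξ hm).le

/-- **THE PHASE-VARIATION BOUND.**  With `ξ = e(h/(e(e+1)))`:
`|K_N(Φ(ξ^· − 1); e(−h/e))| ≤ (π/(8|h|))·(N·V₂(Φ) + 2V₁(Φ)) + (π²/(4e²))·∑_{m≤N}|Φ(m)|`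
(`Φ(N) = Φ(N−1) = 0`, `h ≠ 0`, `2|h| ≤ e`). [this work] -/
theorem norm_kernelSum_phase_le (N : ℕ) {Φ : ℕ → ℂ} (hN : Φ N = 0) (hN' : Φ (N - 1) = 0)
    {e : ℕ} {h : ℤ} (h0 : h ≠ 0) (h2 : 2 * |h| ≤ (e : ℤ)) :
    ‖kernelSum N (fun m => Φ m * (eAdd (e * (e + 1)) h ^ m - 1)) (eAdd e (-h))‖
      ≤ Real.pi / (8 * |(h : ℝ)|) * ((N : ℝ) * ∑ m ∈ range (N + 1), ‖bdiff (bdiff Φ) m‖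
            + 2 * ∑ m ∈ range (N + 1), ‖bdiff Φ m‖)
        + Real.pi ^ 2 / (4 * (e : ℝ) ^ 2) * ∑ m ∈ range (N + 1), ‖Φ m‖ := by
  have habs1 : (1 : ℤ) ≤ |h| := Int.one_le_abs h0
  have he1 : (1 : ℤ) ≤ e := by omega
  have he : e ≠ 0 := by omega
  have he' : (0 : ℝ) < e := by exact_mod_cast (show 0 < e by omega)
  have habs : (0 : ℝ) < |(h : ℝ)| := abs_pos.mpr (by exact_mod_cast h0)
  set ξ : ℂ := eAdd (e * (e + 1)) h with hξ
  have hξ1 : ‖ξ‖ = 1 := norm_eAdd _ _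
  set ρ : ℝ := ‖ξ - 1‖ with hρ
  have hρ0 : 0 ≤ ρ := norm_nonneg _
  have hρle : ρ ≤ 2 * Real.pi * |(h : ℝ)| / ((e : ℝ) * ((e : ℝ) + 1)) := norm_eAdd_mul_succ_sub_one_le he h
  set V₂ := ∑ m ∈ range (N + 1), ‖bdiff (bdiff Φ) m‖ with hV₂
  set V₁ := ∑ m ∈ range (N + 1), ‖bdiff Φ m‖ with hV₁
  set V₀ := ∑ m ∈ range (N + 1), ‖Φ m‖ with hV₀
  have hV₂0 : 0 ≤ V₂ := sum_nonneg fun _ _ => norm_nonneg _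
  have hV₁0 : 0 ≤ V₁ := sum_nonneg fun _ _ => norm_nonneg _
  have hV₀0 : 0 ≤ V₀ := sum_nonneg fun _ _ => norm_nonneg _
  refine (norm_kernelSum_mul_pow_sub_one_le N hN hN' h0 h2 hξ1).trans ?_
  -- `ρ·(e/(4|h|))² ≤ π/(8|h|)` and `ρ²·(e/(4|h|))² ≤ π²/(4e²)`
  have hsq : ((e : ℝ) / (4 * |(h : ℝ)|)) ^ 2 = (e : ℝ) ^ 2 / (16 * |(h : ℝ)| ^ 2) := by
    rw [div_pow]; ring
  have k1 : ρ * ((e : ℝ) / (4 * |(h : ℝ)|)) ^ 2 ≤ Real.pi / (8 * |(h : ℝ)|) := by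
    rw [hsq]
    calc ρ * ((e : ℝ) ^ 2 / (16 * |(h : ℝ)| ^ 2))
        ≤ 2 * Real.pi * |(h : ℝ)| / ((e : ℝ) * ((e : ℝ) + 1)) * ((e : ℝ) ^ 2 / (16 * |(h : ℝ)| ^ 2)) :=
          mul_le_mul_of_nonneg_right hρle (by positivity)
      _ = Real.pi / (8 * |(h : ℝ)|) * ((e : ℝ) / ((e : ℝ) + 1)) := by field_simp; ring
      _ ≤ Real.pi / (8 * |(h : ℝ)|) * 1 :=
          mul_le_mul_of_nonneg_left ((div_le_one (by positivity)).mpr (by linarith)) (by positivity)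
      _ = Real.pi / (8 * |(h : ℝ)|) := mul_one _
  have k2 : ρ ^ 2 * ((e : ℝ) / (4 * |(h : ℝ)|)) ^ 2 ≤ Real.pi ^ 2 / (4 * (e : ℝ) ^ 2) := by
    rw [← mul_pow]
    have h3 : ρ * ((e : ℝ) / (4 * |(h : ℝ)|)) ≤ Real.pi / (2 * ((e : ℝ) + 1)) := by
      calc ρ * ((e : ℝ) / (4 * |(h : ℝ)|))
          ≤ 2 * Real.pi * |(h : ℝ)| / ((e : ℝ) * ((e : ℝ) + 1)) * ((e : ℝ) / (4 * |(h : ℝ)|)) :=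
            mul_le_mul_of_nonneg_right hρle (by positivity)
        _ = Real.pi / (2 * ((e : ℝ) + 1)) := by field_simp; ring
    have h4 : 0 ≤ ρ * ((e : ℝ) / (4 * |(h : ℝ)|)) := by positivity
    calc (ρ * ((e : ℝ) / (4 * |(h : ℝ)|))) ^ 2 ≤ (Real.pi / (2 * ((e : ℝ) + 1))) ^ 2 :=
          pow_le_pow_left₀ h4 h3 2
      _ = Real.pi ^ 2 / (4 * ((e : ℝ) + 1) ^ 2) := by rw [div_pow]; ring
      _ ≤ Real.pi ^ 2 / (4 * (e : ℝ) ^ 2) := by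
          apply div_le_div_of_nonneg_left (by positivity) (by positivity)
          nlinarith
  -- assemble
  have eq1 : ((N : ℝ) * ρ * V₂ + 2 * ρ * V₁ + ρ ^ 2 * V₀) * ((e : ℝ) / (4 * |(h : ℝ)|)) ^ 2
      = (ρ * ((e : ℝ) / (4 * |(h : ℝ)|)) ^ 2) * ((N : ℝ) * V₂ + 2 * V₁)
        + (ρ ^ 2 * ((e : ℝ) / (4 * |(h : ℝ)|)) ^ 2) * V₀ := by ring
  rw [eq1]
  have hNV : 0 ≤ (N : ℝ) * V₂ + 2 * V₁ := by positivity
  exact add_le_add (mul_le_mul_of_nonneg_right k1 hNV) (mul_le_mul_of_nonneg_right k2 hV₀0)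

/-! ### Trapezoid specialisations -/

/-- The top values `Φ_e(N) = Φ_e(N−1) = 0`, `N = X₀ + D + 2`. [this work] -/
theorem trapPhi_top (g : ℤ[X]) (Δ : ℝ) (X₀ D e : ℕ) :
    trapPhi g Δ X₀ D e (X₀ + D + 2) = 0 ∧ trapPhi g Δ X₀ D e (X₀ + D + 2 - 1) = 0 :=
  ⟨trapPhi_of_lt g Δ (by omega) e, trapPhi_of_lt g Δ (by omega) e⟩

/-- The top value `Ψ_e(N) = 0`. [this work] -/
theorem trapPsi_top (g : ℤ[X]) (Δ : ℝ) (X₀ D e : ℕ) : trapPsi g Δ X₀ D e (X₀ + D + 2) = 0 :=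
  trapPsi_of_lt g Δ (by omega) e

/-- **`|K_e(h)| ≤ D·e/(2|h|)`** (first-order Abel with `V₁(Φ_e) ≤ 2D`; hypotheses as in
`sum_norm_bdiff_trapPhi_le`, `h ≠ 0`, `2|h| ≤ e`). [this work] -/
theorem norm_trapKernelSum_le_first (g : ℤ[X]) {Δ : ℝ} (hΔ : 0 < Δ) (X₀ D : ℕ) {e : ℕ} (he : 1 ≤ e)
    (hz : ∀ k : ℕ, g.eval (k : ℤ) ≠ 0) {m₀ A : ℕ} (hA : m₀ ≤ A)
    (hmono : ∀ m m' : ℕ, m₀ ≤ m → m ≤ m' → (g.eval (m : ℤ)).natAbs ≤ (g.eval (m' : ℤ)).natAbs)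
    (hvan : ∀ m : ℕ, m ≤ A + 1 → locWeight g Δ e m = 0) {h : ℤ} (h0 : h ≠ 0) (h2 : 2 * |h| ≤ (e : ℤ)) :
    ‖kernelSum (X₀ + D + 2) (trapPhi g Δ X₀ D e) (eAdd e (-h))‖ ≤ (D : ℝ) * e / (2 * |(h : ℝ)|) := by
  have habs : (0 : ℝ) < |(h : ℝ)| := abs_pos.mpr (by exact_mod_cast h0)
  refine (norm_kernelSum_eAdd_le_first (X₀ + D + 2) (trapPhi_top g Δ X₀ D e).1 h0 h2).trans ?_
  calc (∑ m ∈ range (X₀ + D + 2 + 1), ‖bdiff (trapPhi g Δ X₀ D e) m‖) * ((e : ℝ) / (4 * |(h : ℝ)|))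
      ≤ (2 * D) * ((e : ℝ) / (4 * |(h : ℝ)|)) :=
        mul_le_mul_of_nonneg_right (sum_norm_bdiff_trapPhi_le g hΔ X₀ D he hz hA hmono hvan) (by positivity)
    _ = (D : ℝ) * e / (2 * |(h : ℝ)|) := by field_simp; ring

/-- **`|K_N(Ψ_e; e(−h/(e+1)))| ≤ D(e+1)σ_e/|h|`**, `σ_e = (log(e+1) − log e)/(2Δ)` (first-order Abel with
`V₁(Ψ_e) ≤ 4Dσ_e`; `h ≠ 0`, `2|h| ≤ e + 1`). [this work] -/
theorem norm_trapKernelSum_psi_le (g : ℤ[X]) {Δ : ℝ} (hΔ : 0 < Δ) (X₀ D : ℕ) {e : ℕ} (he : 1 ≤ e)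
    (hz : ∀ k : ℕ, g.eval (k : ℤ) ≠ 0) {m₀ A : ℕ} (hA : m₀ ≤ A)
    (hmono : ∀ m m' : ℕ, m₀ ≤ m → m ≤ m' → (g.eval (m : ℤ)).natAbs ≤ (g.eval (m' : ℤ)).natAbs)
    (hvan : ∀ m : ℕ, m ≤ A + 1 → locWeight g Δ e m = 0) {h : ℤ} (h0 : h ≠ 0)
    (h2 : 2 * |h| ≤ ((e + 1 : ℕ) : ℤ)) :
    ‖kernelSum (X₀ + D + 2) (trapPsi g Δ X₀ D e) (eAdd (e + 1) (-h))‖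
      ≤ (D : ℝ) * ((e : ℝ) + 1) * ((Real.log ((e : ℝ) + 1) - Real.log e) / (2 * Δ)) / |(h : ℝ)| := by
  have habs : (0 : ℝ) < |(h : ℝ)| := abs_pos.mpr (by exact_mod_cast h0)
  have hσ0 := shiftWidth_nonneg hΔ e
  have h1 := norm_kernelSum_eAdd_le_first (X₀ + D + 2) (trapPsi_top g Δ X₀ D e) h0 h2
  push_cast at h1
  refine h1.trans ?_
  calc (∑ m ∈ range (X₀ + D + 2 + 1), ‖bdiff (trapPsi g Δ X₀ D e) m‖) * (((e : ℝ) + 1) / (4 * |(h : ℝ)|))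
      ≤ (4 * D * ((Real.log ((e : ℝ) + 1) - Real.log e) / (2 * Δ))) * (((e : ℝ) + 1) / (4 * |(h : ℝ)|)) :=
        mul_le_mul_of_nonneg_right (sum_norm_bdiff_trapPsi_le g hΔ X₀ D he hz hA hmono hvan) (by positivity)
    _ = (D : ℝ) * ((e : ℝ) + 1) * ((Real.log ((e : ℝ) + 1) - Real.log e) / (2 * Δ)) / |(h : ℝ)| := by
        field_simp

/-- **Phase variation of the trapezoid kernel**: with `V₂(Φ_e) ≤ V`,
`|K_N(Φ_e(ξ^· − 1); e(−h/e))| ≤ (π/(8|h|))·((X₀+D+2)·V + 4D) + (π²/(4e²))·D(X₀+D+3)`. [this work] -/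
theorem norm_trapKernelSum_phase_le (g : ℤ[X]) {Δ : ℝ} (hΔ : 0 < Δ) (X₀ D : ℕ) {e : ℕ} (he : 1 ≤ e)
    (hz : ∀ k : ℕ, g.eval (k : ℤ) ≠ 0) {m₀ A : ℕ} (hA : m₀ ≤ A)
    (hmono : ∀ m m' : ℕ, m₀ ≤ m → m ≤ m' → (g.eval (m : ℤ)).natAbs ≤ (g.eval (m' : ℤ)).natAbs)
    (hvan : ∀ m : ℕ, m ≤ A + 1 → locWeight g Δ e m = 0) {V : ℝ}
    (hV : ∑ m ∈ range (X₀ + D + 3), ‖bdiff (bdiff (trapPhi g Δ X₀ D e)) m‖ ≤ V)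
    {h : ℤ} (h0 : h ≠ 0) (h2 : 2 * |h| ≤ (e : ℤ)) :
    ‖kernelSum (X₀ + D + 2) (fun m => trapPhi g Δ X₀ D e m * (eAdd (e * (e + 1)) h ^ m - 1)) (eAdd e (-h))‖
      ≤ Real.pi / (8 * |(h : ℝ)|) * (((X₀ + D + 2 : ℕ) : ℝ) * V + 4 * D)
        + Real.pi ^ 2 / (4 * (e : ℝ) ^ 2) * ((D : ℝ) * ((X₀ + D + 3 : ℕ) : ℝ)) := by
  have habs : (0 : ℝ) < |(h : ℝ)| := abs_pos.mpr (by exact_mod_cast h0)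
  have he' : (0 : ℝ) < e := by exact_mod_cast he
  have hV₁ := sum_norm_bdiff_trapPhi_le g hΔ X₀ D he hz hA hmono hvan
  have hV₀ := sum_norm_trapPhi_le g Δ X₀ D e
  refine (norm_kernelSum_phase_le (X₀ + D + 2) (trapPhi_top g Δ X₀ D e).1 (trapPhi_top g Δ X₀ D e).2
    h0 h2).trans ?_
  refine add_le_add (mul_le_mul_of_nonneg_left ?_ (by positivity)) (mul_le_mul_of_nonneg_left hV₀ (by positivity))
  have hN0 : (0 : ℝ) ≤ ((X₀ + D + 2 : ℕ) : ℝ) := Nat.cast_nonneg _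
  nlinarith [mul_le_mul_of_nonneg_left hV hN0]

end Summit.Parity.BatemanHorn.Theorems
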